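import Summits.QuantumAdvantage.QuantumAdvantage.Theorems.LinnikCubicClassGroupsDegreeOnePrimesEscapeClassPNTDHThetaDecay
import Summits.QuantumAdvantage.QuantumAdvantage.Theorems.LinnikCubicClassGroupsDegreeOnePrimesEscapeClassPNTTZFormPrelims
import Summits.QuantumAdvantage.QuantumAdvantage.Theorems.LinnikCubicClassGroupsDegreeOnePrimesEscapeClassPNTDHLinnik
import Summits.QuantumAdvantage.QuantumAdvantage.Theorems.LinnikCubicClassGroupsDegreeOnePrimesEscapeClassWindowDH
import HarnessLib

/-!
# Thorner–Zaman (2019) Thm 1.4 for the Hilbert class field at a fixed degree, `θ_C`-form, and the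
# discharge of the named fact `ThornerZaman2019_classPNT_imaginaryQuadratic`

Topic `Summits/QuantumAdvantage/QuantumAdvantage/Theorems`, cell B2b-1 (linnik-cubic), PART A (gen 32);
helper toward the crux `DegreeOnePrimesEscape` (stmt-QuantumAdvantage-11543) of route
`LinnikCubicClassGroups`.  HONEST FRAMING: the value of this file is a THEOREM (kernel-checked, GRH-free,
Siegel-free) — NOT summit progress (the route still rests on the hypothesis-type target
`PureCubicClassNumberHard`).

* `classTheta_TZ_dichotomy (n) (hn : 1 < n)` — **[ThornerZaman2019, Thm. 1.4] for `L = H_K`, in `θ_C`-form,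
  with constants depending on the degree `n` only**: there are `a, c₂, A, s > 0` such that for every number
  field `K` of degree `n` (`Q = |d_K| n^n`, `h = h_K`, `E(t) = errorTermN c₂ Q n t
  = e^{−c₂ log t/log Q} + e^{−√(c₂ log t)/√n}`), EITHER no real class group character has a real zero of
  `L(s, χ)` in `(1 − 1/(8 log Q), 1)` and `|θ_C(t) − t/h| ≤ A E(t) t/h` for all classes `C` and `t ≥ Q^a`, OR
  there are a real `χ₁` and a real zero `β₁ ∈ (1 − 1/(8 log Q), 1)` of `L(s, χ₁)` with `Q^{−s} ≤ 1 − β₁`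
  (Stark) and `|θ_C(t) − (t − χ₁(C) t^{β₁}/β₁)/h| ≤ A E(t) (t − χ₁(C) t^{β₁}/β₁)/h` for all `C`, `t ≥ Q^a`.
  Assembled from `thetaClass_decay` (`…ClassPNTDHThetaDecay.lean`: Deuring–Heilbronn
  `Literature…deuringHeilbronn`, log-free density `fam_density_local`, residue bound
  `Residue.residueLowerBound_all`) by the case analysis of [ThornerZaman2019, §5]: a zero on the exceptional
  segment `excRegion c K` is the `β₁` of the second branch (relative error from `sub_mul_rpow_div_ge`); off the
  segment a real zero in the window has `1 − β ≥ c/log Q` and its term `t^β/β ≤ 2t e^{−c log t/log Q}` is part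
  of the error; with no real zero in the window the first branch holds.
* **`ThornerZaman2019_classPNT_imaginaryQuadratic_holds`** — the tree's NAMED FACT
  `Literature.NumberTheory.LFunctions.NumberField.ThornerZaman2019_classPNT_imaginaryQuadratic`
  (`UniformClassGroupPNT.lean`: [ThornerZaman2019, Thm. 1.4] for the ideal classes of imaginary quadratic
  fields, `π_C`-form, error `c₃(e^{−c₂ log x/log(4|d_K|)} + e^{−(c₂ log x/2)^{1/2}})`) is now a THEOREM:
  `n = 2` and the tree's reduction `ThornerZaman2019_classPNT_imaginaryQuadratic_of_thetaForm`
  (`UniformClassGroupPNTReduction.lean`).  The general-degree fact `…_hilbertClassField` asks for constants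
  uniform in the degree and is NOT claimed.

References: J. Thorner, A. Zaman, *A unified and improved Chebotarev density theorem*, Algebra Number
Theory 13 (2019) 1039–1068, Thm. 1.4, Thm. 3.1–3.3, §5 [ThornerZaman2019]; A. Weiss, J. reine angew.
Math. 338 (1983), Thm. 5.2 [Weiss1983]; J. C. Lagarias, H. L. Montgomery, A. M. Odlyzko, Invent. Math. 54
(1979) [LagariasMontgomeryOdlyzko1979].
-/

noncomputable section

open Complex Real MeasureTheory Set Filter Topology
open scoped NumberField nonZeroDivisors

namespace Summit.QuantumAdvantage.QuantumAdvantage.Theorems.DegreeOnePrimesEscape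

open Literature.NumberTheory.LFunctions Literature.NumberTheory.LFunctions.NumberField
  Literature.NumberTheory.LFunctions.EntireEF Literature.NumberTheory.LFunctions.TZWeight
  Literature.NumberTheory.LFunctions.AbelianDensity

set_option maxHeartbeats 1600000 in
/-- **Thorner–Zaman (2019), Theorem 1.4, for `H_K/K` at a fixed degree `n > 1`, `θ_C`-form with the
Landau–Siegel term and decaying relative error** (see the module docstring; constants depend on `n` only).
[cite: ThornerZaman2019, Theorem 1.4] [cite: Weiss1983, Theorem 5.2] -/
theorem classTheta_TZ_dichotomy (n : ℕ) (hn : 1 < n) :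
    ∃ a c₂ A s : ℝ, 0 < a ∧ 0 < c₂ ∧ 0 < A ∧ 0 < s ∧
    ∀ (K : Type) [Field K] [NumberField K], Module.finrank ℚ K = n →
      ((∀ χ : ClassGroup (𝓞 K) →* ℂˣ, χ * χ = 1 →
          ∀ β : ℝ, 1 - 1 / (8 * Real.log (ThornerZaman.condQn K)) < β → β < 1 →
            classGroupLFunction K χ β ≠ 0) ∧
        ∀ (C : ClassGroup (𝓞 K)) (t : ℝ), ThornerZaman.condQn K ^ a ≤ t →
          |chebyshevThetaIdealClass K C t - t / NumberField.classNumber K| ≤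
            A * ThornerZaman.errorTermN c₂ (ThornerZaman.condQn K) n t * (t / NumberField.classNumber K)) ∨
      ∃ (χ₁ : ClassGroup (𝓞 K) →* ℂˣ) (β₁ : ℝ), χ₁ * χ₁ = 1 ∧
        1 - 1 / (8 * Real.log (ThornerZaman.condQn K)) < β₁ ∧ β₁ < 1 ∧
        classGroupLFunction K χ₁ β₁ = 0 ∧
        ThornerZaman.condQn K ^ (-s) ≤ 1 - β₁ ∧
        ∀ (C : ClassGroup (𝓞 K)) (t : ℝ), ThornerZaman.condQn K ^ a ≤ t →
          |chebyshevThetaIdealClass K C t -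
              (t - ((χ₁ C : ℂ)).re * t ^ β₁ / β₁) / NumberField.classNumber K| ≤
            A * ThornerZaman.errorTermN c₂ (ThornerZaman.condQn K) n t *
              ((t - ((χ₁ C : ℂ)).re * t ^ β₁ / β₁) / NumberField.classNumber K) := by
  classical
  obtain ⟨AR, -, hAR⟩ := Residue.residueLowerBound_all n
  obtain ⟨b, D, hb, hD, hdens⟩ := fam_density_local n hn AR
  have ha : (1 : ℝ) ≤ max AR 4 := le_trans (by norm_num) (le_max_right _ _)
  obtain ⟨a₂, c, κ, A, ha₂1, hc, hcn, hκ0, hA0, hθ⟩ := thetaClass_decay n hn hb hD ha deuringHeilbronn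
  obtain ⟨c₁, hc₁, hc₁1, heff⟩ := Residue.one_sub_realZero_ge_condQn_rpow n hn
  have hn1 : 1 ≤ n := hn.le
  -- constants
  set a : ℝ := max a₂ (max 8 (3 / c)) with hadef
  have haa₂ : a₂ ≤ a := le_max_left _ _
  have ha8 : (8 : ℝ) ≤ a := le_trans (le_max_left _ _) (le_max_right _ _)
  have ha3 : 3 / c ≤ a := le_trans (le_max_right _ _) (le_max_right _ _)
  set c₂ : ℝ := min κ c with hc₂def
  have hc₂κ : c₂ ≤ κ := min_le_left _ _
  have hc₂c : c₂ ≤ c := min_le_right _ _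
  set s : ℝ := 2 + max 0 (Real.log (1 / c₁)) with hsdef
  have hs0 : 0 < s := by have : 0 ≤ max 0 (Real.log (1 / c₁)) := le_max_left _ _; linarith
  refine ⟨a, c₂, 4 * A + 4, s, by linarith, lt_min hκ0 hc, by positivity, hs0, fun K _ _ hKn ↦ ?_⟩
  have hK : 1 < Module.finrank ℚ K := by rw [hKn]; exact hn
  obtain ⟨hgoodK, hexcK⟩ := hθ K hKn (hdens K hKn (hAR K hKn))
  have heffK := heff K hKn
  set Q : ℝ := ThornerZaman.condQn K with hQ
  have hQ12 : (12 : ℝ) ≤ Q := ThornerZaman.twelve_le_condQn (K := K) hK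
  have hQ1 : (1 : ℝ) < Q := by linarith
  have hQ0 : (0 : ℝ) < Q := by linarith
  have hlogQ : 2 ≤ Real.log Q := two_lt_log_twelve.le.trans (Real.log_le_log (by norm_num) hQ12)
  have hlogQ0 : 0 < Real.log Q := by linarith
  set h : ℝ := (NumberField.classNumber K : ℝ) with hh
  have hh1 : 1 ≤ h := by rw [hh]; exact_mod_cast one_le_classNumber (K := K)
  have hh0 : 0 < h := by linarith
  have hstark : Q ^ (-s) ≤ c₁ * Q ^ (-(2 : ℝ)) := rpow_neg_stark_le hQ12 hc₁
  -- the window `1 - 1/(8 log Q) ≥ 3/4`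
  have hwin34 : (3 : ℝ) / 4 ≤ 1 - 1 / (8 * Real.log Q) := by
    have : 1 / (8 * Real.log Q) ≤ 1 / 16 := by
      rw [div_le_div_iff_of_pos_left one_pos (by positivity) (by norm_num)]; linarith
    linarith
  -- sizes at `t ≥ Q^a`
  have hsz : ∀ t : ℝ, Q ^ a ≤ t → Q ^ a₂ ≤ t ∧ 1 < t ∧ 16 ≤ Real.log t ∧
      Real.exp (-(c * Real.log t / Real.log Q)) ≤ 1 / 8 ∧
      (Real.exp (-(κ * Real.log t / Real.log Q)) + Real.exp (-Real.sqrt (κ * Real.log t)) ≤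
        ThornerZaman.errorTermN c₂ Q n t) ∧
      Real.exp (-(c * Real.log t / Real.log Q)) ≤ ThornerZaman.errorTermN c₂ Q n t := by
    intro t ht
    have hta₂ : Q ^ a₂ ≤ t := le_trans (Real.rpow_le_rpow_of_exponent_le hQ1.le haa₂) ht
    have htQ : Q ≤ t := by
      have : Q ^ (1 : ℝ) ≤ Q ^ a := Real.rpow_le_rpow_of_exponent_le hQ1.le (by linarith)
      rw [Real.rpow_one] at this; linarith
    have ht1 : 1 < t := by linarith
    have hL : a * Real.log Q ≤ Real.log t := by
      have := Real.log_le_log (by positivity) ht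
      rwa [Real.log_rpow hQ0] at this
    have hL0 : 0 ≤ Real.log t := by nlinarith
    have hL16 : 16 ≤ Real.log t := by nlinarith
    have hexp8 : Real.exp (-(c * Real.log t / Real.log Q)) ≤ 1 / 8 := by
      have h3 : 3 ≤ c * Real.log t / Real.log Q := by
        rw [le_div_iff₀ hlogQ0]
        have h1 : 3 ≤ c * a := by
          have := (div_le_iff₀ hc).1 ha3; linarith
        nlinarith
      calc Real.exp (-(c * Real.log t / Real.log Q)) ≤ Real.exp (-3) := Real.exp_le_exp.2 (by linarith)
        _ ≤ 1 / 8 := by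
            rw [Real.exp_neg]
            have h20 : (8 : ℝ) ≤ Real.exp 3 := by
              have := Real.add_one_le_exp (3 : ℝ)
              have h' : Real.exp 3 = Real.exp 1 * Real.exp 1 * Real.exp 1 := by
                rw [← Real.exp_add, ← Real.exp_add]; norm_num
              have he := Real.exp_one_gt_d9
              rw [h']; nlinarith [mul_pos (Real.exp_pos (1:ℝ)) (Real.exp_pos (1:ℝ))]
            rw [inv_eq_one_div, div_le_div_iff_of_pos_left one_pos (Real.exp_pos 3) (by norm_num)]
            exact h20
    have hDE : Real.exp (-(κ * Real.log t / Real.log Q)) + Real.exp (-Real.sqrt (κ * Real.log t)) ≤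
        ThornerZaman.errorTermN c₂ Q n t :=
      (decayShape_mono hL0 hlogQ0 hc₂κ).trans (decayShape_le_errorTermN hn1)
    have hcE : Real.exp (-(c * Real.log t / Real.log Q)) ≤ ThornerZaman.errorTermN c₂ Q n t := by
      refine le_trans ?_ ((decayShape_mono hL0 hlogQ0 hc₂c).trans (decayShape_le_errorTermN hn1))
      exact le_add_of_nonneg_right (Real.exp_pos _).le
    exact ⟨hta₂, ht1, hL16, hexp8, hDE, hcE⟩
  by_cases hex : ∃ (ψ : AddChar (Additive (ClassGroup (𝓞 K))) ℂ) (ρ : ℂ),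
      famF K ψ ρ = 0 ∧ 0 < ρ.re ∧ ρ.re < 1 ∧ excRegion c K ρ
  · -- (1a) an exceptional zero on the segment: the second branch, relative error by Deuring–Heilbronn
    right
    obtain ⟨ψ₁, ρ₁, h0₁, hre₁, hre₁', hexc₁⟩ := hex
    obtain ⟨hρ₁, hreal, hLzero, hest⟩ := hexcK ψ₁ ρ₁ h0₁ hre₁ hre₁' hexc₁
    set β₁ : ℝ := ρ₁.re with hβ₁
    set χ₁ : ClassGroup (𝓞 K) →* ℂˣ := (toMulHom ψ₁).toHomUnits with hχ₁
    have hwin : 1 - 1 / (8 * Real.log Q) < β₁ := window_of_excRegion (K := K) hn hKn hcn hexc₁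
    have hβ1 : β₁ < 1 := hre₁'
    have hβ34 : 3 / 4 ≤ β₁ := by linarith
    have hδ : c₁ * Q ^ (-(2 : ℝ)) ≤ 1 - β₁ := heffK χ₁ hreal β₁ hβ1 hLzero
    refine ⟨χ₁, β₁, hreal, hwin, hβ1, hLzero, hstark.trans hδ, fun C t ht ↦ ?_⟩
    obtain ⟨hta₂, ht1, hL16, -, hDE, -⟩ := hsz t ht
    have ht0 : 0 < t := by linarith
    have h1 := hest t hta₂ C
    have hr := abs_re_classGroupChar_apply_le hreal C
    have hmain := sub_mul_rpow_div_ge ht1 hL16 hβ34 hβ1 hr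
    set m : ℝ := min 1 ((1 - β₁) * Real.log t) with hm
    set g : ℝ := t - ((χ₁ C : ℂ)).re * t ^ β₁ / β₁ with hg
    set Dκ : ℝ := Real.exp (-(κ * Real.log t / Real.log Q)) + Real.exp (-Real.sqrt (κ * Real.log t)) with hDκ
    have hDκ0 : 0 < Dκ := by positivity
    have hm0 : 0 ≤ m := le_min zero_le_one (by nlinarith)
    have hg0 : 0 ≤ g := le_trans (by positivity) hmain
    -- `A t Dκ m ≤ 4A Dκ g ≤ (4A+4) E g`
    have hineq : A * t * Dκ * m ≤ (4 * A + 4) * ThornerZaman.errorTermN c₂ Q n t * g := by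
      have h2 : A * t * Dκ * m = A * Dκ * (t * m) := by ring
      have h3 : t * m ≤ 4 * g := by rw [hm, hg]; linarith
      have h4 : A * Dκ * (t * m) ≤ A * Dκ * (4 * g) := mul_le_mul_of_nonneg_left h3 (by positivity)
      have h5 : A * Dκ * (4 * g) ≤ A * ThornerZaman.errorTermN c₂ Q n t * (4 * g) :=
        mul_le_mul_of_nonneg_right (mul_le_mul_of_nonneg_left hDE hA0.le) (by positivity)
      have hE0 : 0 ≤ ThornerZaman.errorTermN c₂ Q n t := (ThornerZaman.errorTermN_pos _ _ _ _).le
      have h6 : 0 ≤ ThornerZaman.errorTermN c₂ Q n t * g := mul_nonneg hE0 hg0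
      nlinarith
    calc |chebyshevThetaIdealClass K C t - g / h|
        ≤ A * t * Dκ * m / h := h1
      _ ≤ (4 * A + 4) * ThornerZaman.errorTermN c₂ Q n t * g / h :=
          div_le_div_of_nonneg_right hineq hh0.le
      _ = (4 * A + 4) * ThornerZaman.errorTermN c₂ Q n t * (g / h) := by ring
  · have hnoexc : ∀ (ψ : AddChar (Additive (ClassGroup (𝓞 K))) ℂ) (ρ : ℂ), famF K ψ ρ = 0 → 0 < ρ.re →
        ρ.re < 1 → ¬ excRegion c K ρ :=
      fun ψ ρ h0 h1 h2 h3 ↦ hex ⟨ψ, ρ, h0, h1, h2, h3⟩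
    have hgood := hgoodK hnoexc
    by_cases hwide : ∃ (χ : ClassGroup (𝓞 K) →* ℂˣ) (β : ℝ), χ * χ = 1 ∧
        1 - 1 / (8 * Real.log Q) < β ∧ β < 1 ∧ classGroupLFunction K χ β = 0
    · -- (1b) a real zero in the window but off the segment: its term is part of the error
      right
      obtain ⟨χ₀, β₀, hreal, hwin, hβ1, hL0⟩ := hwide
      obtain ⟨ψ₀, hψ₀⟩ := exists_toHomUnits_toMulHom_eq χ₀
      have hβ34 : 3 / 4 ≤ β₀ := by linarith
      have hβhalf : 1 / 2 ≤ β₀ := by linarith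
      have hβpos : 0 < β₀ := by linarith
      have hβ1ne : ((β₀ : ℝ) : ℂ) ≠ 1 := by
        intro h'; apply hβ1.ne; exact_mod_cast h'
      have hfam : famF K ψ₀ (β₀ : ℂ) = 0 :=
        famF_eq_zero_of_classGroupLFunction ψ₀ hβ1ne (by rw [hψ₀]; exact hL0)
      have hnot : ¬ excRegion c K (β₀ : ℂ) :=
        hnoexc ψ₀ (β₀ : ℂ) hfam (by rw [Complex.ofReal_re]; exact hβpos) (by rw [Complex.ofReal_re]; exact hβ1)
      have hfar : c / Real.log Q ≤ 1 - β₀ := one_sub_ge_of_not_excRegion (K := K) hK hc hnot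
      have hδ : c₁ * Q ^ (-(2 : ℝ)) ≤ 1 - β₀ := heffK χ₀ hreal β₀ hβ1 hL0
      refine ⟨χ₀, β₀, hreal, hwin, hβ1, hL0, hstark.trans hδ, fun C t ht ↦ ?_⟩
      obtain ⟨hta₂, ht1, hL16, hexp8, hDE, hcE⟩ := hsz t ht
      have ht0 : 0 < t := by linarith
      have h1 := hgood t hta₂ C
      have hr := abs_re_classGroupChar_apply_le hreal C
      set r : ℝ := ((χ₀ C : ℂ)).re with hrdef
      set Dκ : ℝ := Real.exp (-(κ * Real.log t / Real.log Q)) + Real.exp (-Real.sqrt (κ * Real.log t)) with hDκ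
      set E : ℝ := ThornerZaman.errorTermN c₂ Q n t with hEdef
      have hE0 : 0 < E := ThornerZaman.errorTermN_pos _ _ _ _
      -- `t^{β₀} = t e^{-(1-β₀) log t}` and `e^{-(1-β₀) log t} ≤ e^{-c log t/log Q} ≤ 1/8`
      have hexpβ : Real.exp (-((1 - β₀) * Real.log t)) ≤ Real.exp (-(c * Real.log t / Real.log Q)) := by
        rw [Real.exp_le_exp, neg_le_neg_iff]
        have := mul_le_mul_of_nonneg_right hfar (by linarith : (0 : ℝ) ≤ Real.log t)
        rw [div_mul_eq_mul_div] at this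
        exact this
      have hfar8 : Real.exp (-((1 - β₀) * Real.log t)) ≤ 1 / 8 := hexpβ.trans hexp8
      obtain ⟨hg, hrt⟩ := main_ge_half_of_far ht1 hr hβhalf hfar8
      have htβ : t ^ β₀ = t * Real.exp (-((1 - β₀) * Real.log t)) := by
        rw [Real.rpow_def_of_pos ht0, show Real.log t * β₀ = Real.log t + -((1 - β₀) * Real.log t) by ring,
          Real.exp_add, Real.exp_log ht0]
      -- `|r| t^{β₀}/β₀ ≤ 2 t E`
      have hrt2 : |r| * (t ^ β₀ / β₀) ≤ 2 * t * E := by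
        have h2 : t ^ β₀ / β₀ ≤ 2 * t * Real.exp (-((1 - β₀) * Real.log t)) := by
          rw [div_le_iff₀ hβpos, htβ]
          have : 0 ≤ t * Real.exp (-((1 - β₀) * Real.log t)) := by positivity
          nlinarith
        calc |r| * (t ^ β₀ / β₀) ≤ 1 * (2 * t * Real.exp (-((1 - β₀) * Real.log t))) :=
              mul_le_mul hr h2 (by positivity) zero_le_one
          _ ≤ 2 * t * E := by
              rw [one_mul]; exact mul_le_mul_of_nonneg_left (hexpβ.trans hcE) (by positivity)
      set g : ℝ := t - r * t ^ β₀ / β₀ with hgdef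
      -- `|θ − g/h| ≤ |θ − t/h| + |r| t^β₀/(β₀ h) ≤ (A t Dκ + 2 t E)/h ≤ (A+2) t E / h ≤ (4A+4) E g / h`
      have hθg : |chebyshevThetaIdealClass K C t - g / h| ≤ (A * t * Dκ + 2 * t * E) / h := by
        have e1 : chebyshevThetaIdealClass K C t - g / h =
            (chebyshevThetaIdealClass K C t - t / h) + r * (t ^ β₀ / β₀) / h := by
          rw [hgdef]; field_simp; ring
        rw [e1]
        refine (abs_add_le _ _).trans ?_
        rw [add_div]
        refine add_le_add h1 ?_
        rw [abs_div, abs_of_pos hh0, abs_mul]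
        refine div_le_div_of_nonneg_right ?_ hh0.le
        rw [abs_of_nonneg (by positivity : (0 : ℝ) ≤ t ^ β₀ / β₀)]
        exact hrt2
      have hineq : A * t * Dκ + 2 * t * E ≤ (4 * A + 4) * E * g := by
        have h2 : A * t * Dκ ≤ A * t * E := mul_le_mul_of_nonneg_left hDE (by positivity)
        have h3 : (A + 2) * t * E ≤ (4 * A + 4) * E * g := by
          have h4 : t ≤ 2 * g := by linarith
          have h5 : (A + 2) * t * E = (A + 2) * E * t := by ring
          rw [h5]
          have h6 : (A + 2) * E * t ≤ (A + 2) * E * (2 * g) := mul_le_mul_of_nonneg_left h4 (by positivity)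
          have h7 : 0 ≤ E * g := by nlinarith
          nlinarith
        nlinarith
      calc |chebyshevThetaIdealClass K C t - g / h| ≤ (A * t * Dκ + 2 * t * E) / h := hθg
        _ ≤ (4 * A + 4) * E * g / h := div_le_div_of_nonneg_right hineq hh0.le
        _ = (4 * A + 4) * E * (g / h) := by ring
    · -- (2) no real zero in the window: the first branch
      left
      refine ⟨fun χ hχ β hβw hβ1 hL0 ↦ hwide ⟨χ, β, hχ, hβw, hβ1, hL0⟩, fun C t ht ↦ ?_⟩
      obtain ⟨hta₂, ht1, -, -, hDE, -⟩ := hsz t ht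
      have ht0 : 0 < t := by linarith
      have h1 := hgood t hta₂ C
      have hE0 : 0 ≤ ThornerZaman.errorTermN c₂ Q n t := (ThornerZaman.errorTermN_pos _ _ _ _).le
      have hineq : A * t * (Real.exp (-(κ * Real.log t / Real.log Q)) + Real.exp (-Real.sqrt (κ * Real.log t)))
          ≤ (4 * A + 4) * ThornerZaman.errorTermN c₂ Q n t * t := by
        have h2 := mul_le_mul_of_nonneg_left hDE (by positivity : (0 : ℝ) ≤ A * t)
        have h3 : 0 ≤ ThornerZaman.errorTermN c₂ Q n t * t := by positivity
        nlinarith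
      calc |chebyshevThetaIdealClass K C t - t / h|
          ≤ A * t * (Real.exp (-(κ * Real.log t / Real.log Q)) + Real.exp (-Real.sqrt (κ * Real.log t))) / h := h1
        _ ≤ (4 * A + 4) * ThornerZaman.errorTermN c₂ Q n t * t / h := div_le_div_of_nonneg_right hineq hh0.le
        _ = (4 * A + 4) * ThornerZaman.errorTermN c₂ Q n t * (t / h) := by ring

/-- **The named fact `ThornerZaman2019_classPNT_imaginaryQuadratic` holds**: Thorner–Zaman (2019) Thm. 1.4 for
the ideal classes of imaginary quadratic fields — `π_C(x) = h⁻¹ (Li(x) − θ₁ Li(x^{β₁}))(1 + E)`,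
`|E| ≤ c₃ (e^{−c₂ log x/log(4|d_K|)} + e^{−(c₂ log x/2)^{1/2}})` for `x ≥ (4|d_K|)^{c₁}` — is a theorem of the
tree: `classTheta_TZ_dichotomy 2` and the reduction `ThornerZaman2019_classPNT_imaginaryQuadratic_of_thetaForm`.
[cite: ThornerZaman2019, Theorem 1.4] -/
theorem ThornerZaman2019_classPNT_imaginaryQuadratic_holds : ThornerZaman2019_classPNT_imaginaryQuadratic := by
  obtain ⟨a, c₂, A, s, ha, hc₂, hA, hs, H⟩ := classTheta_TZ_dichotomy 2 one_lt_two
  refine ThornerZaman2019_classPNT_imaginaryQuadratic_of_thetaForm ⟨a, c₂, A, s, ha, hc₂, hA, hs, ?_⟩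
  intro K _ _ h2 _
  have hK := H K h2
  rw [ThornerZaman.condQn_eq_condQ K h2] at hK
  simp only [ThornerZaman.errorTermN_two] at hK
  exact hK

end Summit.QuantumAdvantage.QuantumAdvantage.Theorems.DegreeOnePrimesEscape

end
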